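import Mathlib.Algebra.BigOperators.Ring.Finset
import Mathlib.Algebra.Order.BigOperators.Group.Finset
import Mathlib.Algebra.Order.Field.Basic
import Mathlib.Data.Real.Basic
import Mathlib.Tactic.Linarith
import Mathlib.Tactic.FieldSimp
import Mathlib.Tactic.Ring
import HarnessLib

/-!
# Post-selected fidelity of a doped Clifford circuit is bounded by the Clifford reference
# (Martiel et al. 2026, Supplementary Information Theorem S1 / eq. (S9))

Topic `Literature/Computability/QuantumComplexity` (pub-qadeq lane, CLAIMS row E-46: the advantage
METRIC of IBM's doped-Clifford-sampling experiment is a certified fidelity LOWER BOUND, not an XEB).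

HONEST FRAMING: instance-level adjudication of specific advantage claims; no claim about BQP vs BPP
or the summit. This file types the *certificate arithmetic* of the primary as printed; it says
nothing about classical simulation cost (which is where the instance was refuted in print,
Manabe–Gu–Pan arXiv:2608.13110).

## What is formalized

Martiel et al. prepare a stabilizer state `|ψ₁⟩ = C₁|0ⁿ⟩` by a random Clifford circuit equipped with
spacetime Pauli checks, and a "doped" state `|ψ₂⟩ = C₂|0ⁿ⟩` obtained by inserting check-commuting
`T` gates. Under a (possibly correlated) stochastic Pauli fault model with fault paths `E` of
probability `p(E)`, the set `A` of *accepted* fault paths (those commuting with every check's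
back-cumulant) is the same for both circuits, the `T` gates are noiseless, and the post-selected
fidelities are
`F_i = (Σ_{E ∈ A} p(E) f_i(E)) / p_acc`, `p_acc = Σ_{E ∈ A} p(E)`,
with fidelity impacts `f₁(E) = |⟨ψ₁|F(E)|ψ₁⟩|² ∈ {0,1}` (a stabilizer state: `1` on the *harmless*
set `H = {E ∈ A ∖ {I} : F(E) ∈ Stab |ψ₁⟩}`, `0` on the *harmful* set `L`) and
`0 ≤ f₂(E) = |⟨ψ₂|F̃(E)|ψ₂⟩|² ≤ 1`, the identity fault contributing equally to both
[cite: MartielEtAl2026, SI §S2.2 p. S9–S10]. The printed conclusion is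

`F₂ − F₁ = −(Σ_{E∈H} p(E)(1 − f₂(E)))/p_acc + (Σ_{E∈L} p(E) f₂(E))/p_acc`, hence
`F₂ ≥ F₁ − Pr(E ∈ H ∣ E ∈ A)`                                   [cite: MartielEtAl2026, SI Thm S1 (S5) and eq. (S9)]

("the first term lower bounds the fidelity difference and the second term upper bounds it").
In the experiment `F₁ = 0.32(1)` (direct fidelity estimation, 80 stabilizers), the maximal drop
`Pr(E ∈ H ∣ E ∈ A)` is estimated as `0.013(1)`, and the advertised bound is `F₂ ≥ 0.284` at 95 %
confidence [cite: MartielEtAl2026, Fig. 3 (caption) p. 4]; the statistical treatment of those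
numbers is NOT formalized here — only the deterministic inequality they are fed into
(`cliffordFidelity_sub_le_dopedFidelity`, and the two-sided form `dopedFidelity_mem_Icc`).

Everything is elementary real arithmetic over a `Finset` of fault paths; the quantum objects
(`|ψ_i⟩`, `F(E)`, the checks) enter only through the hypotheses `f₁ ∈ {0,1}` on `A`,
`0 ≤ f₂ ≤ 1`, and `f₂(I) = f₁(I)`. 0 named facts; all statements proved.

## References

* [MartielEtAl2026] S. Martiel, J.-U. Chung, A. Seif, S. Ghosh, I. Hincks, A. Deshpande,
  B. Fefferman, J. M. Gambetta, A. Javadi-Abhari, *Sampling hard circuits with verifiably high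
  fidelity*, arXiv:2607.25941v1 (28 Jul 2026): Fig. 1c and Fig. 3 (p. 2, 4); Supplementary
  Information §S2 "Bounding state fidelity after T-doping", Theorem S1 (eq. (S5)), §S2.2
  eq. (S9) (SI p. S8–S10). Read via `lit read arxiv:2607.25941` (PDF pp. 21, 24–26).
* [ManabeGuPan2026] H. Manabe, H. Gu, F. Pan, *Classical Simulation and Design Frontiers for IBM's
  Doped Clifford Sampling Experiment*, arXiv:2608.13110v1 (13 Aug 2026) — context only (the
  instance-level classical simulation; not used in any statement below).
-/

noncomputable section

open Finset

namespace Literature.Computability.QuantumComplexity.DopedClifford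

variable {ι : Type*}

/-- Acceptance probability (post-selection rate) `p_acc = Σ_{E ∈ A} p(E)` of the accepted fault
set `A` under the fault distribution `p`. [cite: MartielEtAl2026, SI §S2.2] -/
def accProb (A : Finset ι) (p : ι → ℝ) : ℝ :=
  ∑ E ∈ A, p E

/-- Post-selected fidelity `F = (Σ_{E ∈ A} p(E) f(E)) / p_acc` for a fidelity-impact function
`f(E) = |⟨ψ|F(E)|ψ⟩|²` on accepted fault paths. [cite: MartielEtAl2026, SI §S2.2] -/
def psFidelity (A : Finset ι) (p f : ι → ℝ) : ℝ :=
  (∑ E ∈ A, p E * f E) / accProb A p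

/-- Conditional probability `Pr(E ∈ S ∣ E ∈ A) = (Σ_{E ∈ S} p(E)) / p_acc` of a sub-family
`S ⊆ A` of accepted faults. [cite: MartielEtAl2026, SI eq. (S9)] -/
def condProb (A S : Finset ι) (p : ι → ℝ) : ℝ :=
  (∑ E ∈ S, p E) / accProb A p

variable [DecidableEq ι]

/-- The HARMLESS accepted faults of the Clifford reference: accepted, not the identity fault `one`,
and stabilizing `|ψ₁⟩`, i.e. `f₁(E) = 1`:  `H = {E ∈ A ∖ {I} : F(E) ∈ Stab(|ψ₁⟩)}`.
[cite: MartielEtAl2026, SI Thm S1] -/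
def harmless (A : Finset ι) (one : ι) (f₁ : ι → ℝ) : Finset ι :=
  (A.erase one).filter fun E => f₁ E = 1

/-- The HARMFUL accepted faults of the Clifford reference: accepted, non-identity, `f₁(E) = 0`
(`F(E) ∉ Stab(|ψ₁⟩)`):  `L = {E ∈ A : E ≠ I, F(E) ∉ Stab(|ψ₁⟩)}`.
[cite: MartielEtAl2026, SI §S2.2] -/
def harmful (A : Finset ι) (one : ι) (f₁ : ι → ℝ) : Finset ι :=
  (A.erase one).filter fun E => f₁ E = 0

/-- Harmless faults are accepted faults. [folklore] -/
theorem harmless_subset (A : Finset ι) (one : ι) (f₁ : ι → ℝ) : harmless A one f₁ ⊆ A :=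
  (filter_subset _ _).trans (erase_subset _ _)

/-- Harmful faults are accepted faults. [folklore] -/
theorem harmful_subset (A : Finset ι) (one : ι) (f₁ : ι → ℝ) : harmful A one f₁ ⊆ A :=
  (filter_subset _ _).trans (erase_subset _ _)

/-- Membership in the harmless set, unfolded. [folklore] -/
theorem mem_harmless {A : Finset ι} {one E : ι} {f₁ : ι → ℝ} :
    E ∈ harmless A one f₁ ↔ E ∈ A ∧ E ≠ one ∧ f₁ E = 1 := by
  simp only [harmless, mem_filter, mem_erase]; tauto

/-- Membership in the harmful set, unfolded. [folklore] -/
theorem mem_harmful {A : Finset ι} {one E : ι} {f₁ : ι → ℝ} :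
    E ∈ harmful A one f₁ ↔ E ∈ A ∧ E ≠ one ∧ f₁ E = 0 := by
  simp only [harmful, mem_filter, mem_erase]; tauto

/-- The harmless and harmful sets are disjoint (`f₁` cannot be both `1` and `0`). [folklore] -/
theorem disjoint_harmless_harmful (A : Finset ι) (one : ι) (f₁ : ι → ℝ) :
    Disjoint (harmless A one f₁) (harmful A one f₁) := by
  rw [Finset.disjoint_left]
  intro E h1 h2
  rw [mem_harmless] at h1
  rw [mem_harmful] at h2
  have := h1.2.2
  rw [h2.2.2] at this
  exact zero_ne_one this

omit [DecidableEq ι] in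
/-- The fidelity DIFFERENCE identity: `p_acc · (F₂ − F₁) = Σ_{E ∈ A} p(E) (f₂(E) − f₁(E))`
(both circuits share the fault distribution on the common accepted set).
[cite: MartielEtAl2026, SI §S2.2 (first display)] -/
theorem accProb_mul_sub (A : Finset ι) (p f₁ f₂ : ι → ℝ) (hacc : accProb A p ≠ 0) :
    accProb A p * (psFidelity A p f₂ - psFidelity A p f₁) = ∑ E ∈ A, p E * (f₂ E - f₁ E) := by
  unfold psFidelity
  rw [← sub_div, mul_div_cancel₀ _ hacc, ← sum_sub_distrib]
  refine sum_congr rfl fun E _ => by ring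

/-- On the accepted set of a stabilizer reference (`f₁ ∈ {0,1}` on `A`), `A` splits as
`{one} ∪ H ∪ L` when `one ∈ A`: the sum of `g` over `A` is `g one + Σ_H g + Σ_L g`
(the regrouping used in [cite: MartielEtAl2026, SI §S2.2]). [folklore] -/
theorem sum_accepted_split (A : Finset ι) (one : ι) (f₁ : ι → ℝ) (hone : one ∈ A)
    (h01 : ∀ E ∈ A, f₁ E = 0 ∨ f₁ E = 1) (g : ι → ℝ) :
    ∑ E ∈ A, g E = g one + ∑ E ∈ harmless A one f₁, g E + ∑ E ∈ harmful A one f₁, g E := by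
  have hsplit : A.erase one = harmless A one f₁ ∪ harmful A one f₁ := by
    ext E
    simp only [mem_union, mem_harmless, mem_harmful, mem_erase]
    constructor
    · rintro ⟨hne, hA⟩
      rcases h01 E hA with h | h
      · exact Or.inr ⟨hA, hne, h⟩
      · exact Or.inl ⟨hA, hne, h⟩
    · rintro (⟨hA, hne, -⟩ | ⟨hA, hne, -⟩) <;> exact ⟨hne, hA⟩
  rw [← Finset.add_sum_erase A g hone, hsplit,
    sum_union (disjoint_harmless_harmful A one f₁), add_assoc]

/-- **Fidelity-difference decomposition** [cite: MartielEtAl2026, SI §S2.2 (third display)]: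
with a stabilizer reference (`f₁ = 1` on `H`, `0` on `L`) and the identity fault contributing
equally to both circuits,
`p_acc (F₂ − F₁) = −Σ_{E∈H} p(E)(1 − f₂(E)) + Σ_{E∈L} p(E) f₂(E)`. -/
theorem accProb_mul_sub_eq (A : Finset ι) (one : ι) (p f₁ f₂ : ι → ℝ) (hacc : accProb A p ≠ 0)
    (hone : one ∈ A) (h01 : ∀ E ∈ A, f₁ E = 0 ∨ f₁ E = 1) (hid : f₂ one = f₁ one) :
    accProb A p * (psFidelity A p f₂ - psFidelity A p f₁) =
      -(∑ E ∈ harmless A one f₁, p E * (1 - f₂ E)) + ∑ E ∈ harmful A one f₁, p E * f₂ E := by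
  rw [accProb_mul_sub A p f₁ f₂ hacc, sum_accepted_split A one f₁ hone h01, hid, sub_self,
    mul_zero, zero_add, neg_eq_neg_one_mul, mul_sum]
  congr 1
  · refine sum_congr rfl fun E hE => ?_
    rw [(mem_harmless.mp hE).2.2]; ring
  · refine sum_congr rfl fun E hE => ?_
    rw [(mem_harmful.mp hE).2.2]; ring

/-- **Theorem S1 / eq. (S9) of Martiel et al.: the doped state's post-selected fidelity is at least
the Clifford reference fidelity minus the conditional probability of harmless faults**:
`F₂ ≥ F₁ − Pr(E ∈ H ∣ E ∈ A)`.
Hypotheses as printed: common fault distribution `p ≥ 0` with `p_acc > 0`; `f₁ ∈ {0,1}` on `A`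
(stabilizer state); `f₂ ≥ 0` (a squared overlap); the identity fault `one ∈ A` contributes equally
(`f₂(I) = f₁(I)`). (`f₂ ≤ 1` is not needed for this direction.)
[cite: MartielEtAl2026, SI Thm S1 (S5), eq. (S9)] -/
theorem cliffordFidelity_sub_le_dopedFidelity (A : Finset ι) (one : ι) (p f₁ f₂ : ι → ℝ)
    (hp : ∀ E ∈ A, 0 ≤ p E) (hacc : 0 < accProb A p) (hone : one ∈ A)
    (h01 : ∀ E ∈ A, f₁ E = 0 ∨ f₁ E = 1) (hf₂ : ∀ E ∈ A, 0 ≤ f₂ E) (hid : f₂ one = f₁ one) :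
    psFidelity A p f₁ - condProb A (harmless A one f₁) p ≤ psFidelity A p f₂ := by
  have key := accProb_mul_sub_eq A one p f₁ f₂ hacc.ne' hone h01 hid
  -- lower bound the right-hand side by `−Σ_H p`
  have hH : -(∑ E ∈ harmless A one f₁, p E) ≤
      -(∑ E ∈ harmless A one f₁, p E * (1 - f₂ E)) + ∑ E ∈ harmful A one f₁, p E * f₂ E := by
    have h1 : ∑ E ∈ harmless A one f₁, p E * (1 - f₂ E) ≤ ∑ E ∈ harmless A one f₁, p E := by
      refine sum_le_sum fun E hE => ?_
      have hA := harmless_subset A one f₁ hE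
      have := hp E hA; have := hf₂ E hA
      nlinarith
    have h2 : 0 ≤ ∑ E ∈ harmful A one f₁, p E * f₂ E :=
      sum_nonneg fun E hE => mul_nonneg (hp E (harmful_subset A one f₁ hE))
        (hf₂ E (harmful_subset A one f₁ hE))
    linarith
  rw [← key] at hH
  -- divide by `p_acc > 0`
  unfold condProb
  have h' : -(psFidelity A p f₂ - psFidelity A p f₁) ≤
      (∑ E ∈ harmless A one f₁, p E) / accProb A p := by
    rw [le_div_iff₀ hacc]; linarith [hH]
  linarith [h']

/-- The upper direction printed alongside (S9): `F₂ ≤ F₁ + Pr(E ∈ L ∣ E ∈ A)` ("any fidelity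
improvement due to doping only helps"), which needs `f₂ ≤ 1`.
[cite: MartielEtAl2026, SI §S2.2] -/
theorem dopedFidelity_le_cliffordFidelity_add (A : Finset ι) (one : ι) (p f₁ f₂ : ι → ℝ)
    (hp : ∀ E ∈ A, 0 ≤ p E) (hacc : 0 < accProb A p) (hone : one ∈ A)
    (h01 : ∀ E ∈ A, f₁ E = 0 ∨ f₁ E = 1) (hf₂ : ∀ E ∈ A, 0 ≤ f₂ E ∧ f₂ E ≤ 1)
    (hid : f₂ one = f₁ one) :
    psFidelity A p f₂ ≤ psFidelity A p f₁ + condProb A (harmful A one f₁) p := by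
  have key := accProb_mul_sub_eq A one p f₁ f₂ hacc.ne' hone h01 hid
  have hL : -(∑ E ∈ harmless A one f₁, p E * (1 - f₂ E)) + ∑ E ∈ harmful A one f₁, p E * f₂ E
      ≤ ∑ E ∈ harmful A one f₁, p E := by
    have h1 : 0 ≤ ∑ E ∈ harmless A one f₁, p E * (1 - f₂ E) :=
      sum_nonneg fun E hE => mul_nonneg (hp E (harmless_subset A one f₁ hE))
        (by have := (hf₂ E (harmless_subset A one f₁ hE)).2; linarith)
    have h2 : ∑ E ∈ harmful A one f₁, p E * f₂ E ≤ ∑ E ∈ harmful A one f₁, p E := by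
      refine sum_le_sum fun E hE => ?_
      have hA := harmful_subset A one f₁ hE
      have := hp E hA; have := (hf₂ E hA).2
      nlinarith
    linarith
  rw [← key] at hL
  unfold condProb
  have h' : psFidelity A p f₂ - psFidelity A p f₁ ≤
      (∑ E ∈ harmful A one f₁, p E) / accProb A p := by
    rw [le_div_iff₀ hacc]; linarith [hL]
  linarith [h']

/-- Both directions packaged: `F₂ ∈ [F₁ − Pr(H ∣ A), F₁ + Pr(L ∣ A)]`.
[cite: MartielEtAl2026, SI §S2.2 and eq. (S9)] -/
theorem dopedFidelity_mem_Icc (A : Finset ι) (one : ι) (p f₁ f₂ : ι → ℝ)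
    (hp : ∀ E ∈ A, 0 ≤ p E) (hacc : 0 < accProb A p) (hone : one ∈ A)
    (h01 : ∀ E ∈ A, f₁ E = 0 ∨ f₁ E = 1) (hf₂ : ∀ E ∈ A, 0 ≤ f₂ E ∧ f₂ E ≤ 1)
    (hid : f₂ one = f₁ one) :
    psFidelity A p f₂ ∈ Set.Icc (psFidelity A p f₁ - condProb A (harmless A one f₁) p)
      (psFidelity A p f₁ + condProb A (harmful A one f₁) p) :=
  ⟨cliffordFidelity_sub_le_dopedFidelity A one p f₁ f₂ hp hacc hone h01 (fun E hE => (hf₂ E hE).1)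
    hid, dopedFidelity_le_cliffordFidelity_add A one p f₁ f₂ hp hacc hone h01 hf₂ hid⟩

omit [DecidableEq ι] in
/-- How the certificate is USED (the deterministic step behind "we lower bound the fidelity of the
hard doped state to F₂ ≥ 0.284", Fig. 3d): any lower estimate `a ≤ F₁` of the Clifford fidelity and
any upper estimate `Pr(H ∣ A) ≤ b` of the harmless-fault probability give `a − b ≤ F₂`.  The
printed inputs are `F₁ = 0.32(1)` and a maximal drop `0.013(1)`; their statistical treatment is
not formalized. [cite: MartielEtAl2026, Fig. 3 caption p. 4] -/
theorem dopedFidelity_ge_of_estimates {F₁ F₂ q a b : ℝ} (hcert : F₁ - q ≤ F₂) (ha : a ≤ F₁)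
    (hb : q ≤ b) : a - b ≤ F₂ := by
  linarith

end Literature.Computability.QuantumComplexity.DopedClifford

end
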